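import Summits.QuantumFields.YangMills.Theorems.SwapVirialDeficitNearFlatTuple
import HarnessLib

/-!
# NEAR-FLAT PROJECTION OF THE LEADER QUADRUPLE (quaternion level): a unit quadruple `(C₀, C₁, C₂, c)` with a heavy element is within `O(relations)/‖im C_h‖` of a FLAT one
# (free-hands support of ⟨stmt-QuantumFields-24197⟩ `SwapVirialDeficit.SwapGluedStiffness`; steps (iii)–(iv) of the near-flat projection of LEAD g98's plan of record memo7 §C(c);
# the transfer to `SU(2)` ∕ `chartDeficit` via ✓`chartBox_of_chartDeficit` and the central-corner fallback (v) are the sequel)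

In the leader chart the flat set of the principal sector is (✓`chartDeficit_eq_zero_iff`): `C₀, C₁, C₂` pairwise commute, `c·C_{σμ} = C_μ·c` (`σ = (0 1)`), followers `= 1`.  For a
COAXIAL quadruple the σ-relations reduce to `C₁ = C₀`.  So: project every leader onto the axis of the heavy one (✓`exists_coaxial_tuple`), then replace `C₁` by the projected `C₀`;
the extra cost is `‖C₁ − C₀‖ ≤ ‖cC₁ − C₀c‖ + ‖C₀c − cC₀‖` (unit `c`):
* `norm_sub_le_rel_add_comm` (that inequality), ★★ `exists_flatQuat_near (C : Fin 4 → ℍ) (hunit : ∀ k, ‖C k‖ = 1) (h) (hh : (C h).im ≠ 0)`: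
  `∃ C♭`, unit, pairwise commuting, `C♭ 1 = C♭ 0` (hence all σ-relations), with `‖C k − C♭ k‖ ≤ ‖[C h, C k]‖/‖im C h‖` for `k ≠ 1` and
  `‖C 1 − C♭ 1‖ ≤ ‖C 3·C 1 − C 0·C 3‖ + ‖C 0·C 3 − C 3·C 0‖ + ‖[C h, C 0]‖/‖im C h‖`.

HONEST LABEL: elementary quaternion geometry; stubs of ➎, ⟨24197⟩ ∕ ⟨24194⟩ ∕ ⟨24497⟩ OPEN; own crux ⟨22884⟩ OPEN (blocked-on ⟨19935⟩); the Yang–Mills mass gap is NOT proved; no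
summit is proved by a line.  THEOREMS ONLY (0 `def`, 0 `sorry`), standard axioms.  Width seat ym-line-sfw-p2-w3 g66 (cell ym-idea-1, free hands), `--supports stmt-QuantumFields-24197`.
References: [folklore].
-/

set_option autoImplicit false

noncomputable section

open Quaternion
open scoped Quaternion

namespace Summit.QuantumFields.YangMills.Theorems.SwapVirialDeficit.NearFlat

/-- For a unit `c`: `‖C₁ − C₀‖ ≤ ‖c·C₁ − C₀·c‖ + ‖C₀·c − c·C₀‖`. [folklore] -/
theorem norm_sub_le_rel_add_comm {c : ℍ} (hc : ‖c‖ = 1) (C₀ C₁ : ℍ) : ‖C₁ - C₀‖ ≤ ‖c * C₁ - C₀ * c‖ + ‖C₀ * c - c * C₀‖ := by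
  have e : ‖C₁ - C₀‖ = ‖c * C₁ - c * C₀‖ := by rw [← mul_sub, norm_mul, hc, one_mul]
  rw [e]
  calc ‖c * C₁ - c * C₀‖ = ‖(c * C₁ - C₀ * c) + (C₀ * c - c * C₀)‖ := by congr 1; abel
    _ ≤ ‖c * C₁ - C₀ * c‖ + ‖C₀ * c - c * C₀‖ := norm_add_le _ _

/-- ★★ **NEAR-FLAT PROJECTION OF A UNIT QUADRUPLE WITH A HEAVY ELEMENT** (quaternion level; index `3` is the hub `c`, `σ = (0 1)`). [folklore] -/
theorem exists_flatQuat_near (C : Fin 4 → ℍ) (hunit : ∀ k, ‖C k‖ = 1) (h : Fin 4) (hh : (C h).im ≠ 0) :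
    ∃ Cf : Fin 4 → ℍ, (∀ k, ‖Cf k‖ = 1) ∧ (∀ k l, Cf k * Cf l = Cf l * Cf k) ∧ Cf 1 = Cf 0 ∧
      (∀ k, k ≠ 1 → ‖C k - Cf k‖ ≤ ‖C h * C k - C k * C h‖ / ‖(C h).im‖) ∧
      ‖C 1 - Cf 1‖ ≤ ‖C 3 * C 1 - C 0 * C 3‖ + ‖C 0 * C 3 - C 3 * C 0‖ + ‖C h * C 0 - C 0 * C h‖ / ‖(C h).im‖ := by
  obtain ⟨C', hre, hax, hnorm, hcomm, hfix, hdist⟩ := exists_coaxial_tuple C h hh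
  have hunit' : ∀ k, ‖C' k‖ = 1 := fun k => by
    have h1 := hnorm k
    rw [hunit k, one_pow] at h1
    have h0 : 0 ≤ ‖C' k‖ := norm_nonneg _
    nlinarith [h1, h0]
  refine ⟨Function.update C' 1 (C' 0), ?_, ?_, ?_, ?_, ?_⟩
  · intro k
    by_cases hk : k = 1
    · subst hk; rw [Function.update_self]; exact hunit' 0
    · rw [Function.update_of_ne hk]; exact hunit' k
  · intro k l
    by_cases hk : k = 1 <;> by_cases hl : l = 1
    · subst hk; subst hl; rfl
    · subst hk; rw [Function.update_self, Function.update_of_ne hl]; exact hcomm 0 l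
    · subst hl; rw [Function.update_self, Function.update_of_ne hk]; exact hcomm k 0
    · rw [Function.update_of_ne hk, Function.update_of_ne hl]; exact hcomm k l
  · rw [Function.update_self, Function.update_of_ne (by decide : (0 : Fin 4) ≠ 1)]
  · intro k hk
    rw [Function.update_of_ne hk]; exact hdist k
  · rw [Function.update_self]
    calc ‖C 1 - C' 0‖ = ‖(C 1 - C 0) + (C 0 - C' 0)‖ := by congr 1; abel
      _ ≤ ‖C 1 - C 0‖ + ‖C 0 - C' 0‖ := norm_add_le _ _
      _ ≤ (‖C 3 * C 1 - C 0 * C 3‖ + ‖C 0 * C 3 - C 3 * C 0‖) + ‖C h * C 0 - C 0 * C h‖ / ‖(C h).im‖ :=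
          add_le_add (norm_sub_le_rel_add_comm (hunit 3) (C 0) (C 1)) (hdist 0)
      _ = _ := by ring

end Summit.QuantumFields.YangMills.Theorems.SwapVirialDeficit.NearFlat

end
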